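/-
Origin: expansion seat `planner-pub-hodgecm-pv13-0`, handover 2026-08-18T03:55:20Z (`HOME/pub-hodgecm-pv13/lean/Pv13/SchurConstituents.lean`, md5 fb5bbb6e, 163 lines);
landed by the gen-5 packager in gate run 20 as `HodgeCM/PerL34/SchurConstituents.lean` (import ^import Pv[0-9]+\.→import HodgeCM.PerL34. ×1).
-/
/-
Origin: pub-hodgecm-pv13 (DAG-NODE PROVER #13), toward node N31h (ii) (PerL v5 ll. 633–635).  Imports this seat's
`Pv13.SchurUnitary` (→ `HodgeCM.PerL34.SchurUnitary` on landing) and Mathlib only.  Proposed place: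
`HodgeCM/PerL34/SchurConstituents.lean`, namespace `HodgeCM.PerL34.Schur`.  Nothing cited, nothing asserted.
-/
import Summits.HodgeConjecture.HodgeCM.PerL34.SchurUnitary
import Mathlib.Analysis.InnerProductSpace.Projection.Basic

set_option autoImplicit false

/-!
# Constituents of a space generated by lifts (kernel glue for N31h (ii))

PerL v5 l. 633–635: "`π_i` is generated by the `θ(φ, χ′_i)` with `φ_b` in the isotypic parts singled out in (a),
which realise `J⁺` at `ι₁` and `𝟏` at `b ≠ ι₁` …; so every irreducible constituent of the closure of `π_i` has
archimedean component `J⁺ ⊗ 𝟏^{⊗}`".  Abstractly: a unitary representation `τ` of `G = G_b` on `H = L²`, an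
IRREDUCIBLE unitary representation `ρ` of `G` on `V` (the isotypic piece `V_{χ̄′_b}` of the local oscillator
representation), and a family of bounded intertwiners `θ_j : V → H` (the lifts with the off-`b` data `j` frozen);
`π` is the closed span of `⋃_j θ_j(V)`.  THEOREM (`exists_isometry_into_of_le_closure_span`): every non-zero CLOSED
`τ`-invariant subspace `K` of that closed span receives a non-zero intertwiner `P_K ∘ θ_j` from `V`, hence (by the
Schur file) contains an equivariant isometric copy of `V` — "`V` occurs in every constituent".  The two print
inputs that turn this into the text's conclusion (irreducibility of `V_{χ̄′_b}` and `V ≅ J⁺`/`𝟏`; `𝒜^{1,0}` by the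
archimedean component) are Borel–Wallach VIII 2.10/2.14 and VI 4.11/VII 4.11 (GAPS.md pv13/N31h(ii) addendum 2).
-/

noncomputable section

open scoped InnerProductSpace ComplexConjugate
open ContinuousLinearMap

namespace HodgeCM
namespace PerL34
namespace Schur

variable {H : Type*} [NormedAddCommGroup H] [InnerProductSpace ℂ H] [CompleteSpace H]

/-- If `K` is invariant under a family closed under adjoints, so is `Kᗮ`. -/
theorem invariant_orthogonal {S : Set (H →L[ℂ] H)} (hstar : ∀ s ∈ S, star s ∈ S) (K : Submodule ℂ H)
    (hK : Invariant S K) : Invariant S Kᗮ := by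
  intro s hs w hw
  rw [Submodule.mem_orthogonal] at hw ⊢
  intro k hk
  rw [← adjoint_inner_left, ← star_eq_adjoint]
  exact hw _ (hK (star s) (hstar s hs) k hk)

/-- The orthogonal projection onto a closed subspace invariant under an adjoint-closed family COMMUTES with the
family. -/
theorem commute_starProjection {S : Set (H →L[ℂ] H)} (hstar : ∀ s ∈ S, star s ∈ S) (K : Submodule ℂ H)
    [K.HasOrthogonalProjection] (hK : Invariant S K) : ∀ s ∈ S, Commute s K.starProjection := by
  intro s hs
  have hKo := invariant_orthogonal hstar K hK
  change s * K.starProjection = K.starProjection * s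
  ext x
  change s (K.starProjection x) = K.starProjection (s x)
  symm
  apply Submodule.eq_starProjection_of_mem_orthogonal
  · exact hK s hs _ (K.starProjection_apply_mem x)
  · have h : s x - s (K.starProjection x) = s (x - K.starProjection x) := by rw [map_sub]
    rw [h]
    exact hKo s hs _ (K.sub_starProjection_mem_orthogonal x)

section Lifts

variable {G : Type*} [Group G]
variable {V : Type*} [NormedAddCommGroup V] [InnerProductSpace ℂ V] [CompleteSpace V]
variable {ρ : G →* unitary (V →L[ℂ] V)} {τ : G →* unitary (H →L[ℂ] H)}

/-- Composing an intertwiner with the projection onto a closed invariant subspace gives an intertwiner. -/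
theorem Intertwines.starProjection_comp {T : V →L[ℂ] H} (hT : Intertwines ρ τ T) (K : Submodule ℂ H)
    [K.HasOrthogonalProjection] (hK : Invariant (ops τ) K) :
    Intertwines ρ τ (K.starProjection ∘L T) := by
  intro g
  have hc := commute_starProjection (star_mem_ops τ) K hK _ ⟨g, rfl⟩
  rw [comp_assoc, hT g, ← comp_assoc, ← mul_def, ← hc.eq, mul_def, comp_assoc]

/-- **Every constituent of the closed span of lifts contains the lifted irreducible.**  Let `ρ` be irreducible,
`θ_j : V → H` bounded `(ρ, τ)`-intertwiners, and `K ≠ ⊥` a closed `τ`-invariant subspace of the closed span of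
`⋃_j θ_j(V)`.  Then some `P_K ∘ θ_j ≠ 0`, and `V` embeds into `K` by a `(ρ, τ)`-equivariant linear isometry (a
positive multiple of `P_K ∘ θ_j`), whose image is a closed `τ`-invariant subspace of `K`. -/
theorem exists_isometry_into_of_le_closure_span (hρ : Irreducible ρ) {ι : Type*} (θ : ι → (V →L[ℂ] H))
    (hθ : ∀ j, Intertwines ρ τ (θ j)) (K : Submodule ℂ H) (hKc : IsClosed (K : Set H))
    (hKinv : Invariant (ops τ) K) (hK0 : K ≠ ⊥)
    (hKle : K ≤ (⨆ j, LinearMap.range (θ j).toLinearMap).topologicalClosure) :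
    ∃ (j : ι) (U : V →ₗᵢ[ℂ] H),
      (∀ x, U x ∈ K) ∧ IsClosed (Set.range U) ∧
      (∀ (g : G) (y : H), y ∈ Set.range U → (τ g : H →L[ℂ] H) y ∈ Set.range U) ∧
      (∀ (g : G) (x : V), U ((ρ g : V →L[ℂ] V) x) = (τ g : H →L[ℂ] H) (U x)) ∧
      ∃ a : ℝ, 0 < a ∧ ∀ x, (a : ℂ) • θ j x - U x ∈ Kᗮ := by
  -- (the last clause says `U x = P_K (a • θ_j x)`, `P_K` the orthogonal projection, since `U x ∈ K`)
  haveI : CompleteSpace K := hKc.completeSpace_coe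
  -- some `P_K ∘ θ_j` is non-zero
  have hex : ∃ j, K.starProjection ∘L θ j ≠ 0 := by
    by_contra hall
    push Not at hall
    apply hK0
    have hle : (⨆ j, LinearMap.range (θ j).toLinearMap) ≤ Kᗮ := by
      refine iSup_le fun j => ?_
      rintro _ ⟨x, rfl⟩
      have h0 : K.starProjection (θ j x) = 0 := by
        have := congrArg (fun T : V →L[ℂ] H => T x) (hall j)
        simpa using this
      have hx : θ j x ∈ (K.starProjection).ker := h0
      rwa [Submodule.ker_starProjection] at hx
    have hle' : (⨆ j, LinearMap.range (θ j).toLinearMap).topologicalClosure ≤ Kᗮ :=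
      Submodule.topologicalClosure_minimal _ hle (Submodule.isClosed_orthogonal K)
    have hKK : K ≤ K ⊓ Kᗮ := le_inf le_rfl (hKle.trans hle')
    rw [Submodule.inf_orthogonal_eq_bot] at hKK
    exact le_bot_iff.mp hKK
  obtain ⟨j, hj⟩ := hex
  have hT : Intertwines ρ τ (K.starProjection ∘L θ j) := (hθ j).starProjection_comp K hKinv
  obtain ⟨U, ⟨a, ha, hUa⟩, hU⟩ := exists_linearIsometry_of_intertwiner_ne_zero hρ hT hj
  have hmem : ∀ x, U x ∈ K := fun x => by
    rw [hUa x]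
    exact K.smul_mem _ (K.starProjection_apply_mem _)
  refine ⟨j, U, hmem, U.isometry.isClosedEmbedding.isClosed_range, ?_, hU, a, ha, fun x => ?_⟩
  · rintro g _ ⟨x, rfl⟩
    exact ⟨(ρ g : V →L[ℂ] V) x, hU g x⟩
  · rw [hUa x, ContinuousLinearMap.comp_apply, ← smul_sub]
    exact Kᗮ.smul_mem _ (K.sub_starProjection_mem_orthogonal _)

/-- The same with the conclusion packaged as: `V` is unitarily equivalent to a closed `τ`-invariant subspace
`K' ≤ K` (the constituent `K` "contains `ρ`"), equivariantly. -/
theorem exists_invariant_subspace_equiv (hρ : Irreducible ρ) {ι : Type*} (θ : ι → (V →L[ℂ] H))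
    (hθ : ∀ j, Intertwines ρ τ (θ j)) (K : Submodule ℂ H) (hKc : IsClosed (K : Set H))
    (hKinv : Invariant (ops τ) K) (hK0 : K ≠ ⊥)
    (hKle : K ≤ (⨆ j, LinearMap.range (θ j).toLinearMap).topologicalClosure) :
    ∃ (K' : Submodule ℂ H) (U : V ≃ₗᵢ[ℂ] K'), K' ≤ K ∧ IsClosed (K' : Set H) ∧ Invariant (ops τ) K' ∧
      ∀ (g : G) (x : V), ((U ((ρ g : V →L[ℂ] V) x) : K') : H) = (τ g : H →L[ℂ] H) ((U x : K') : H) := by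
  obtain ⟨j, U, hmem, hclosed, hinv, hU, -⟩ :=
    exists_isometry_into_of_le_closure_span hρ θ hθ K hKc hKinv hK0 hKle
  let K' : Submodule ℂ H := LinearMap.range U.toLinearMap
  have hcoe : (K' : Set H) = Set.range U := by
    ext y
    simp [K']
  let U₀ : V →ₗᵢ[ℂ] K' :=
    { toLinearMap := U.toLinearMap.rangeRestrict
      norm_map' := fun x => by
        rw [Submodule.coe_norm]
        exact U.norm_map x }
  have hsurj : Function.Surjective U₀ := by
    rintro ⟨_, ⟨x, rfl⟩⟩
    exact ⟨x, rfl⟩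
  refine ⟨K', LinearIsometryEquiv.ofSurjective U₀ hsurj, ?_, ?_, ?_, ?_⟩
  · rintro _ ⟨x, rfl⟩
    exact hmem x
  · rw [hcoe]
    exact hclosed
  · intro s hs y hy
    obtain ⟨g, rfl⟩ := hs
    have hy' : y ∈ Set.range U := by rw [← hcoe]; exact hy
    have := hinv g y hy'
    rw [← hcoe] at this
    exact this
  · intro g x
    exact hU g x

end Lifts

end Schur
end PerL34
end HodgeCM

end
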